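import Literature.Computability.QuantumComplexity.StabilizerSimulationGadgetProofs
import HarnessLib

/-!
# The projector onto a stabilizer state as a product of generator projections

Topic `Literature/Computability/QuantumComplexity`, namespace `StabilizerFormalism` (continuing
`StabilizerSimulationGadgetProofs.lean`); second support file for the discharge of
`MehrabanTahmasbi2024_PSharpP_subset_PPoly_of_stabilizerRank_poly` (`StabilizerRankPermanent.lean`).
Mehraban–Tahmasbi (arXiv:2305.10277, proof of Thm. 1.6, p. 6) store "the full description of
`φ₁, …, φ_r`" as polynomial advice and evaluate `⟨0ⁿ1 0^m| C_f (|0^{n+1}⟩ ⊗ φᵢ)⟩` "using the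
Gottesman–Knill algorithm". Over the tree's OPERATIONAL stabilizer states (`stabilizerStates m` =
the orbit of `|0^m⟩` under arbitrarily long Clifford words) a polynomial-size, PHASE-EXACT description
is obtained here from the Heisenberg picture: for `Φ = W|0^m⟩` the conjugated generators
`g_j = W Z_j W⁻¹ = i^{k_j} X^{a_j} Z^{b_j}` (`pushesPauli_and_pullsPauli_of_mem`) satisfy

  `(∏_j ½(1 + g_j)) |z⟩ = W⁻¹[0^m, z] · Φ`     for every basis state `|z⟩`,

and `W⁻¹[0^m, z] ≠ 0` for some `z` (a row of an invertible matrix). This is the standard fact that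
`∏_j ½(1 + g_j) = |Φ⟩⟨Φ|` is the projector onto the stabilized line (Nielsen–Chuang 2010, §10.5.1,
eq. (10.88)–(10.89) area; Aaronson–Gottesman 2004, §II), in the form that needs neither unitarity nor
the commutation/independence of the `g_j`: only `g_j W = W Z_j` and `W W⁻¹ = 1` are used. The sequel
(`StabilizerProjectorWords.lean`) realises `∏_j ½(1 + g_j)` by measurement gadgets
(`H`–controlled-`g_j`–`H` on an ancilla, postselected on `0`), i.e. by an explicit Clifford WORD of
length `O(m²)` — the advice actually stored.

* `genData W` / `gen_mul` — chosen generator data `(k_j, a_j, b_j)` with `g_j W = W Z_j`;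
* `halfProj`, `projList` — `½(1 + g)` and the ordered product `∏_{j<m} ½(1 + g_j)`;
* `projList_mul_eq` — `(∏ ½(1+g_j)) W = W ∏ ½(1+Z_j)`; `zProjList_mulVec_basisState` —
  `(∏_{j<m} ½(1+Z_j))|x⟩ = [x = 0^m] |x⟩`;
* **`projList_mulVec_basisState`** — `(∏ ½(1+g_j))|z⟩ = W'[0,z] · W|0^m⟩` for a right inverse `W'`;
* `exists_row_entry_ne_zero` — a left-invertible matrix has a non-zero entry in row `0^m`;
* **`exists_projector_presentation`** — every `Φ ∈ stabilizerStates m` is `s⁻¹ (∏ ½(1+g_j))|z⟩` for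
  explicit data `(k, a, b, z)` and a scalar `s ≠ 0`.

## References

* S. Mehraban, M. Tahmasbi, arXiv:2305.10277 (STOC 2024), proof of Thm. 1.6, p. 6.
* M. A. Nielsen, I. L. Chuang, *Quantum Computation and Quantum Information*, CUP 2010, §10.5.1
  (stabilizer formalism; the projector `∏ (I + g_j)/2`), §10.5.3 (measurement of Pauli observables
  with an ancilla).
* S. Aaronson, D. Gottesman, *Improved simulation of stabilizer circuits*, PRA 70 (2004) 052328, §II–III.
-/

noncomputable section

namespace Literature.Computability.QuantumComplexity

open _root_.Computability Cryptography Matrix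

namespace StabilizerFormalism

variable {m : ℕ}

/-! ### Generator data of a Clifford circuit -/

/-- The all-zero label `0^m`. [folklore] -/
abbrev zlab (m : ℕ) : QReg m := fun _ => false

/-- The Pauli `Z_j = X^0 Z^{e_j}`. [folklore] -/
abbrev zOp (j : Fin m) : Matrix (QReg m) (QReg m) ℂ := pauliOp (zlab m) (Pi.single j true)

/-- `Z_j |x⟩ = (-1)^{x_j} |x⟩`. [folklore] -/
theorem zOp_mulVec_basisState (j : Fin m) (x : QReg m) :
    zOp j *ᵥ basisState x = (if x j then (-1 : ℂ) else 1) • basisState x := by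
  rw [pauliOp_mulVec_basisState, sgn_single_left, bxor_zero]

/-- **Generator data.** For a Clifford circuit `W` there are `k_j, a_j, b_j` with
`(i^{k_j} X^{a_j} Z^{b_j}) W = W Z_j` for every wire `j` (push `Z_j` through `W`).
[cite: AaronsonGottesman2004, §III] -/
theorem exists_gen {W : Matrix (QReg m) (QReg m) ℂ} (hW : W ∈ cliffordCircuits m) (j : Fin m) :
    ∃ (k : ℕ) (a b : QReg m), (Complex.I ^ k • pauliOp a b) * W = W * zOp j := by
  obtain ⟨k, a, b, e⟩ := (pushesPauli_and_pullsPauli_of_mem hW).1 0 (zlab m) (Pi.single j true)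
  refine ⟨k, a, b, ?_⟩
  rw [← e, pow_zero, one_smul]

/-- A choice of generator data `(k_j, a_j, b_j)_{j<m}` for `W`. [folklore] -/
def genData {W : Matrix (QReg m) (QReg m) ℂ} (hW : W ∈ cliffordCircuits m) (j : Fin m) : ℕ × QReg m × QReg m :=
  ⟨Classical.choose (exists_gen hW j), Classical.choose (Classical.choose_spec (exists_gen hW j)),
    Classical.choose (Classical.choose_spec (Classical.choose_spec (exists_gen hW j)))⟩

/-- The signed Pauli `g = i^k X^a Z^b` of a data triple. [folklore] -/
def sPauli (d : ℕ × QReg m × QReg m) : Matrix (QReg m) (QReg m) ℂ := Complex.I ^ d.1 • pauliOp d.2.1 d.2.2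

/-- The defining relation of the generator data: `g_j W = W Z_j`. [cite: AaronsonGottesman2004, §III] -/
theorem gen_mul {W : Matrix (QReg m) (QReg m) ℂ} (hW : W ∈ cliffordCircuits m) (j : Fin m) :
    sPauli (genData hW j) * W = W * zOp j :=
  Classical.choose_spec (Classical.choose_spec (Classical.choose_spec (exists_gen hW j)))

/-! ### Products of projections `½(1 + g)` -/

/-- `½(1 + g)`. [cite: NielsenChuang2010, §10.5.1] -/
def halfProj (g : Matrix (QReg m) (QReg m) ℂ) : Matrix (QReg m) (QReg m) ℂ := (1 / 2 : ℂ) • (1 + g)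

/-- The ordered product `∏_{j ∈ js} ½(1 + g_j)` (first index leftmost). [cite: NielsenChuang2010, §10.5.1] -/
def projList (g : Fin m → Matrix (QReg m) (QReg m) ℂ) (js : List (Fin m)) : Matrix (QReg m) (QReg m) ℂ :=
  (js.map fun j => halfProj (g j)).prod

/-- The empty product. [folklore] -/
@[simp] theorem projList_nil (g : Fin m → Matrix (QReg m) (QReg m) ℂ) : projList g [] = 1 := by
  simp [projList]

/-- One more factor on the left. [folklore] -/
theorem projList_cons (g : Fin m → Matrix (QReg m) (QReg m) ℂ) (j : Fin m) (js : List (Fin m)) :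
    projList g (j :: js) = halfProj (g j) * projList g js := by
  simp [projList]

/-- Conjugation of one projection: if `g W = W Z` then `½(1+g) W = W ½(1+Z)`. [folklore] -/
theorem halfProj_mul_eq {g Z W : Matrix (QReg m) (QReg m) ℂ} (h : g * W = W * Z) :
    halfProj g * W = W * halfProj Z := by
  unfold halfProj
  rw [Matrix.smul_mul, Matrix.mul_smul, Matrix.add_mul, Matrix.mul_add, Matrix.one_mul, Matrix.mul_one, h]

/-- **`(∏ ½(1+g_j)) W = W ∏ ½(1+Z_j)`** whenever `g_j W = W Z_j` for all `j`. [cite: NielsenChuang2010, §10.5.1] -/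
theorem projList_mul_eq {g : Fin m → Matrix (QReg m) (QReg m) ℂ} {W : Matrix (QReg m) (QReg m) ℂ}
    (h : ∀ j, g j * W = W * zOp j) (js : List (Fin m)) :
    projList g js * W = W * projList zOp js := by
  induction js with
  | nil => simp
  | cons j js ih => rw [projList_cons, projList_cons, Matrix.mul_assoc, ih, ← Matrix.mul_assoc, halfProj_mul_eq (h j),
      Matrix.mul_assoc]

/-- `½(1 + Z_j)|x⟩ = [x_j = 0] |x⟩`. [cite: NielsenChuang2010, §10.5.3] -/
theorem halfProj_zOp_mulVec_basisState (j : Fin m) (x : QReg m) :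
    halfProj (zOp j) *ᵥ basisState x = if x j then 0 else basisState x := by
  unfold halfProj
  rw [Matrix.smul_mulVec, Matrix.add_mulVec, Matrix.one_mulVec, zOp_mulVec_basisState]
  by_cases hx : x j
  · simp [hx]
  · simp only [hx, Bool.false_eq_true, if_false, one_smul, smul_add]
    rw [← add_smul]; norm_num

/-- `(∏_{j ∈ js} ½(1+Z_j))|x⟩ = [∀ j ∈ js, x_j = 0] |x⟩`. [cite: NielsenChuang2010, §10.5.3] -/
theorem zProjList_mulVec_basisState (js : List (Fin m)) (x : QReg m) :
    projList zOp js *ᵥ basisState x = if (∀ j ∈ js, x j = false) then basisState x else 0 := by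
  induction js with
  | nil => simp
  | cons j js ih =>
    rw [projList_cons, ← Matrix.mulVec_mulVec, ih]
    by_cases hjs : ∀ j' ∈ js, x j' = false
    · rw [if_pos hjs, halfProj_zOp_mulVec_basisState]
      by_cases hx : x j
      · rw [if_pos hx, if_neg]; simp [hx]
      · rw [if_neg hx, if_pos]; simpa [hx] using hjs
    · rw [if_neg hjs, Matrix.mulVec_zero, if_neg]
      simp only [List.mem_cons, forall_eq_or_imp, not_and]
      exact fun _ => hjs

/-- Over all wires: `(∏_{j<m} ½(1+Z_j))|x⟩ = [x = 0^m] |x⟩`. [cite: NielsenChuang2010, §10.5.3] -/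
theorem zProjList_finRange_mulVec_basisState (x : QReg m) :
    projList zOp (List.finRange m) *ᵥ basisState x = if x = zlab m then basisState x else 0 := by
  rw [zProjList_mulVec_basisState]
  by_cases hx : x = zlab m
  · rw [if_pos hx, if_pos]; intro j _; rw [hx]
  · rw [if_neg hx, if_neg]
    intro h; exact hx (funext fun j => h j (List.mem_finRange j))

/-- **The projector formula on basis states.** If `g_j W = W Z_j` for all `j` and `W W' = 1`, then
`(∏_{j<m} ½(1+g_j)) |z⟩ = W'[0^m, z] · W|0^m⟩` — the product of the generator projections applied to a
basis state is a multiple of the stabilizer state `Φ = W|0^m⟩` (`∏ ½(1+g_j) = |Φ⟩⟨Φ|` when `W` is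
unitary). [cite: NielsenChuang2010, §10.5.1] -/
theorem projList_mulVec_basisState {g : Fin m → Matrix (QReg m) (QReg m) ℂ} {W W' : Matrix (QReg m) (QReg m) ℂ}
    (h : ∀ j, g j * W = W * zOp j) (hWW' : W * W' = 1) (z : QReg m) :
    projList g (List.finRange m) *ᵥ basisState z = W' (zlab m) z • (W *ᵥ zeroState m) := by
  have e : projList g (List.finRange m) = W * projList zOp (List.finRange m) * W' := by
    rw [← projList_mul_eq h, Matrix.mul_assoc, hWW', Matrix.mul_one]
  rw [e, ← Matrix.mulVec_mulVec, ← Matrix.mulVec_mulVec, mulVec_basisState W' z]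
  have hsum : (fun x => W' x z) = ∑ x : QReg m, W' x z • basisState x := by
    funext x'
    simp only [Finset.sum_apply, Pi.smul_apply, basisState_apply, smul_eq_mul, mul_ite, mul_one, mul_zero,
      Finset.sum_ite_eq, Finset.mem_univ, if_true]
  rw [hsum, Matrix.mulVec_sum, Finset.sum_eq_single (zlab m)]
  · rw [Matrix.mulVec_smul, zProjList_finRange_mulVec_basisState, if_pos rfl, Matrix.mulVec_smul]
    rfl
  · intro x _ hx
    rw [Matrix.mulVec_smul, zProjList_finRange_mulVec_basisState, if_neg hx, smul_zero]
  · intro h; exact absurd (Finset.mem_univ _) h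

/-- A matrix with a left inverse has a non-zero entry in every row; here row `0^m`. [folklore] -/
theorem exists_row_entry_ne_zero {W W' : Matrix (QReg m) (QReg m) ℂ} (h : W' * W = 1) :
    ∃ z, W' (zlab m) z ≠ 0 := by
  by_contra hz
  push Not at hz
  have h00 := congrFun (congrFun h (zlab m)) (zlab m)
  rw [Matrix.mul_apply, Matrix.one_apply_eq] at h00
  have : ∑ z, W' (zlab m) z * W z (zlab m) = 0 := Finset.sum_eq_zero fun z _ => by rw [hz z, zero_mul]
  rw [this] at h00
  exact zero_ne_one h00

/-- **Presentation of a stabilizer state by its generator projections.** For `Φ ∈ stabilizerStates m`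
there are generator data `(k_j, a_j, b_j)_{j<m}`, a basis label `z` and a scalar `s ≠ 0` with
`(∏_{j<m} ½(1 + i^{k_j} X^{a_j} Z^{b_j})) |z⟩ = s · Φ`. (This is the "description of `φᵢ`" stored as
advice in the proof of Mehraban–Tahmasbi 2024, Thm. 1.6, in projector form.)
[cite: MehrabanTahmasbi2024, proof of Theorem 1.6 (arXiv p. 6)] -/
theorem exists_projector_presentation {Φ : QReg m → ℂ} (hΦ : Φ ∈ stabilizerStates m) :
    ∃ (d : Fin m → ℕ × QReg m × QReg m) (z : QReg m) (s : ℂ), s ≠ 0 ∧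
      projList (fun j => sPauli (d j)) (List.finRange m) *ᵥ basisState z = s • Φ := by
  obtain ⟨W, hW, rfl⟩ := hΦ
  obtain ⟨W', -, hl, hr⟩ := exists_inverse_of_mem_cliffordCircuits hW
  obtain ⟨z, hz⟩ := exists_row_entry_ne_zero hl
  exact ⟨genData hW, z, W' (zlab m) z, hz, projList_mulVec_basisState (gen_mul hW) hr z⟩

end StabilizerFormalism

end Literature.Computability.QuantumComplexity
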